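import Literature.MathematicalPhysics.QuantumFieldTheory.Balaban1983to89.Node00.SmallFieldDomOfRecord

/-!
# NODE 00 — the MEMBERSHIP small-field domain of record `domUOfRecord ν εbg ρ K k`: [I] p. 259's FIRST printed form («`|∂U_k(V) − 1| < ε₀η²`»,
# i.e. `U_k(V) ∈ 𝔘_k(ε₀)`, p. 260) READ ON THE SOLVABLE-UNIQUE SET of (1.1), inside the second-form set `domAltOfRecord`, with the membership
# radius `ρ` an explicit letter — the (1.1)-domain on which door v1.3 of NODE N09 keys its [B11] rows (pub-ymgap FLAG №7′, DESIGN MEMO door v1.3 §5)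

Cell `pub-ymgap` (YM-PLAN Track A), seat `pub-ymgap-dag-n09-w1` g8 (R523 (a), director-ym №307 (2)(P1)); home per node00-def RR-2 WORD-7 (Q-v13-2 (a): Node00, next to
def-R's `domOfRecord` ∕ `domAltOfRecord`).  `--kind definition`; count-neutral helper of K1⁹ stmt-QuantumFields-27364.  [I] = [Balaban1987RG1] (CMP 109), [B11] = [Balaban1985Variational]
(CMP 102) (= «[15]» of [I]), [B7] = [Balaban1985Averaging] (CMP 98).  Imports def-R's `Node00.SmallFieldDomOfRecord` only (so `Uk`, `UkExists`, `UniqueUkOrbit`, `bgReg`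
(node00-def-B), `domAltOfRecord`, `domOfRecord` (def-R) are in scope); NO new object besides the one `def`.

WHY.  The Stage-8…13 record cores pin the (1.1)-domain `dom := fun p k => domAltOfRecord θ.ν p.K k` = [I] p. 259's SECOND form «`|∂V − 1| < ε₀`», which print calls «technically less
convenient»; [I] states the k-th action on the FIRST form ∕ MEMBERSHIP domain «`U_k(V) ∈ 𝔘_k(ε₀)`» (p. 260; p. 265 «we define χ_k in such a way that the domain of integration is restricted to
configurations V for which `U_k(V) ∈ 𝔘_k(ε₀)`»).  pub-ymgap's FLAG №7′ located that NODE N09's door rows ([B11] Thm 1 (1.1) `h11`, the (8)-membership row `hreg8`, `HRestrict`∕`huniq`) keyed on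
the second form are jointly outside [B11] Thm 1 AS PRINTED (the inner∕outer invariant `2B₃ ≤ L²` of every plaquette-keyed domain, and the empty radius window `[2B₃r∕L², a₀]` for once-averaged data
at one radius — `Summits/…/BalabanUVNodesN09Reg8RowAtEqualRadiiLocated`).  The cure as printed is to key (1.1) on MEMBERSHIP with a membership radius `ρ` SMALL against [B11]'s `a₀`
(`2B₃ρ ≤ a₀L²`).  This file types that domain as a total `Set`, per level, with all radii explicit:
  `domUOfRecord ν εbg ρ K k := {V | V ∈ domAltOfRecord ν K k ∧ UkExists K k εbg V ∧ UniqueUkOrbit K k εbg V ∧ Uk K k εbg V ∈ bgReg K k ρ}`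
— `εbg` = the radius at which the minimiser of record is TAKEN and uniqueness is STATED (the record's `θ.εbg`; print: any radius in `[ε₀, a₀]`), `ρ` = the membership radius (print's `ε₀` of
`𝔘_k(ε₀)`), `ν.ε₀` = the outer plaquette threshold (conjunct 1 keeps every `domAltOfRecord`-keyed analytic lemma applicable by restriction).  On it (1.1) and the (8)-row are DEFINITIONAL
(conjuncts 2–4); at one radius (`εbg ≤ ρ`) the membership conjunct is vacuous (`Uk_mem_bgReg` — the collapsed regime of the Z3 pin `εreg = εbg = a₀`); with `εbg := ν.εreg`, `ρ ≤ ν.ε₀` it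
refines def-R's first form `domOfRecord` on the solvable set.  THIS FILE = the definition and its `Iff.rfl` unfolding ONLY (statement-only lane); every bookkeeping lemma (the definitional
rows, monotonicity in `ρ`, the collapsed regime, the relation to `domOfRecord`, gauge-stability, the level-nesting kernel, the inner inhabitation from N07's slot) is typed Summits-side in
NODE N09's door files, which need Summits lemmas anyway.
HONEST FRAMING: one definition of record + definitional bookkeeping; nothing of Bałaban's asserted ((1.1) on this set holds BY DEFINITION of the set, not by a theorem); no record core edited
(the cores still read `domAltOfRecord`; a core edition `dom := domUOfRecord …` is a director-level event, DESIGN MEMO §6 (D1′)); no satisfiability claimed; counts unmoved; one finite `T⁴` per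
run; NOT continuum ∕ ℝ⁴ ∕ OS ∕ mass-gap ∕ Clay.  No `instance`, no `notation`, no `sorry`.
-/

noncomputable section

namespace Literature.MathematicalPhysics.QuantumFieldTheory.Balaban1983to89.Node00

open T4Continuum

variable (F : T4Family) (N : ℕ) [NeZero N]

/-! ## §1 The membership domain of record -/

/-- **The MEMBERSHIP small-field domain of record** at level `k` of the `K`-th torus: the second-form small fields `V` ([I] p. 259, `|∂V − 1| < ν.ε₀`) whose level-`k` variational problem
(0.21) is solvable within the class `bgReg K k εbg` with a unique minimal residual orbit ((1.1)) AND whose minimiser of record lies in the smaller class `bgReg K k ρ` — [I] p. 259 first form ∕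
p. 260 «`U_k(V) ∈ 𝔘_k(ε₀)`» with membership radius `ρ`.  Total `Set`; all radii explicit arguments (no `Stage7Numerics`∕`Stage13Params` field added). [cite: Balaban1987RG1, p.259, (1.1)–(1.2) p.260 and p.265] -/
def domUOfRecord (ν : Stage7Numerics) (εbg ρ : ℝ) (K k : ℕ) : Set (GaugeField (F.P K) k (SU N)) :=
  {V | V ∈ domAltOfRecord F N ν K k ∧ UkExists F N K k εbg V ∧ UniqueUkOrbit F N K k εbg V ∧ Uk F N K k εbg V ∈ bgReg F N K k ρ}

variable {F N}

/-- Membership, unfolded. [cite: Balaban1987RG1, p.259 and (1.1)–(1.2) p.260 (bookkeeping)] -/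
theorem mem_domUOfRecord_iff (ν : Stage7Numerics) (εbg ρ : ℝ) (K k : ℕ) (V : GaugeField (F.P K) k (SU N)) :
    V ∈ domUOfRecord F N ν εbg ρ K k ↔
      V ∈ domAltOfRecord F N ν K k ∧ UkExists F N K k εbg V ∧ UniqueUkOrbit F N K k εbg V ∧ Uk F N K k εbg V ∈ bgReg F N K k ρ := Iff.rfl

end Literature.MathematicalPhysics.QuantumFieldTheory.Balaban1983to89.Node00

end
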